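import Mathlib.Algebra.MvPolynomial.PDeriv
import Mathlib.Algebra.MvPolynomial.NoZeroDivisors
import Mathlib.Algebra.Polynomial.Derivative
import Mathlib.Algebra.Polynomial.Div
import Mathlib.RingTheory.Polynomial.UniqueFactorization
import Mathlib.Analysis.SpecificLimits.Basic
import Mathlib.Analysis.Complex.Basic
import Mathlib.Topology.Algebra.Polynomial
import Literature.Algebra.Polynomial.JacobianCriterion
import HarnessLib

/-!
# K1-B meridian package, G2 part (c): elementary order / multiplicity lemmas for the pair centre
# (route `SignSymmetricPowers`, item stmt-HodgeConjecture-19716; helper for GEN / LINK-G)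

Helper file (`--supports stmt-HodgeConjecture-19716`), pure algebra / one-variable analysis, consumed by
`SignSymmetricPowersGenPairCentre`:

* `exists_open_subset_of_subset_iUnion_closed` — a non-empty open set covered by finitely many closed sets contains a
  non-empty open subset of one of them (no Baire category needed);
* `not_X_pow_three_dvd_of_tendsto_div_sq` — a polynomial `P ∈ ℂ[X]` with `P(c)/c² → L ≠ 0` (`c → 0`, `c ≠ 0`) is not
  divisible by `X³`;
* `X_sq_dvd_of_eval_zero_of_derivative_eval_zero` — `P(0) = P'(0) = 0 ⇒ X² ∣ P`;
* `two_le_of_dvd_pderiv` — in `ℂ[x_σ]`: if an irreducible `h` with `h ∤ R` divides every partial `∂_k (h^e · R)` and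
  `e ≥ 1`, then `e ≥ 2` (for `e = 1` it would divide every `∂_k h`, hence be a constant).

Sorry-free; axioms standard; no definition, no named fact.

## References

* [VoisinHodgeII2003] C. Voisin, Hodge Theory and Complex Algebraic Geometry II (CUP 2003), §2.1.1 (context only).
-/

noncomputable section

set_option linter.dupNamespace false

open _root_.Topology _root_.Filter

namespace Summit.HodgeConjecture.HodgeConjecture.Theorems.SignSymmetricPowersGenPairOrder

/-! ### §1 Finite closed covers of an open set -/

/-- **A non-empty open set covered by finitely many closed sets contains a non-empty open subset of one of them.**
(Induction on the number of sets: either `B ⊆ F i₀`, or `B \\ F i₀` is a smaller non-empty open set covered by the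
others.) [folklore] -/
theorem exists_open_subset_of_subset_iUnion_closed {X ι : Type*} [TopologicalSpace X] (s : Finset ι)
    (F : ι → Set X) (hF : ∀ i ∈ s, IsClosed (F i)) {B : Set X} (hB : IsOpen B) (hne : B.Nonempty)
    (hcover : B ⊆ ⋃ i ∈ s, F i) :
    ∃ i ∈ s, ∃ B' : Set X, IsOpen B' ∧ B'.Nonempty ∧ B' ⊆ B ∧ B' ⊆ F i := by
  classical
  induction s using Finset.induction_on generalizing B with
  | empty =>
    obtain ⟨x, hx⟩ := hne
    simpa using hcover hx
  | insert i₀ s hi₀ ih =>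
    by_cases hsub : B ⊆ F i₀
    · exact ⟨i₀, Finset.mem_insert_self _ _, B, hB, hne, le_rfl, hsub⟩
    · -- `B \\ F i₀` is open, non-empty and covered by the remaining closed sets
      have hB' : IsOpen (B \ F i₀) := hB.sdiff (hF i₀ (Finset.mem_insert_self _ _))
      have hne' : (B \ F i₀).Nonempty := by
        obtain ⟨x, hxB, hxF⟩ := Set.not_subset.mp hsub
        exact ⟨x, hxB, hxF⟩
      have hcover' : B \ F i₀ ⊆ ⋃ i ∈ s, F i := by
        intro x hx
        have := hcover hx.1
        simp only [Finset.set_biUnion_insert, Set.mem_union] at this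
        rcases this with h | h
        · exact absurd h hx.2
        · exact h
      obtain ⟨i, hi, B', hB'o, hB'ne, hB'B, hB'F⟩ :=
        ih (fun i hi => hF i (Finset.mem_insert_of_mem hi)) hB' hne' hcover'
      exact ⟨i, Finset.mem_insert_of_mem hi, B', hB'o, hB'ne, hB'B.trans Set.sdiff_subset, hB'F⟩

/-! ### §2 Orders of vanishing of univariate polynomials -/

/-- If `P(c)/c² → L` along `c → 0`, `c ≠ 0`, with `L ≠ 0`, then `X³ ∤ P`. [folklore] -/
theorem not_X_pow_three_dvd_of_tendsto_div_sq {P : Polynomial ℂ} {L : ℂ} (hL : L ≠ 0)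
    (hlim : Tendsto (fun c : ℂ => P.eval c / c ^ 2) (𝓝[≠] 0) (𝓝 L)) : ¬ Polynomial.X ^ 3 ∣ P := by
  rintro ⟨R, hR⟩
  -- `P(c)/c² = c · R(c)` for `c ≠ 0`, which tends to `0`
  have heq : ∀ᶠ c in 𝓝[≠] (0 : ℂ), P.eval c / c ^ 2 = c * R.eval c := by
    filter_upwards [self_mem_nhdsWithin] with c hc
    rw [hR, Polynomial.eval_mul, Polynomial.eval_pow, Polynomial.eval_X]
    field_simp
  have hlim0 : Tendsto (fun c : ℂ => c * R.eval c) (𝓝[≠] 0) (𝓝 0) := by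
    have h1 : Tendsto (fun c : ℂ => c * R.eval c) (𝓝 0) (𝓝 (0 * R.eval 0)) :=
      (continuous_id.mul (R.continuous_eval₂ _)).tendsto 0 |>.congr (fun _ => rfl)
    rw [zero_mul] at h1
    exact h1.mono_left nhdsWithin_le_nhds
  have := tendsto_nhds_unique (hlim.congr' heq) hlim0
  exact hL this

/-- `P(0) = 0` and `P'(0) = 0` imply `X² ∣ P`. [folklore] -/
theorem X_sq_dvd_of_eval_zero_of_derivative_eval_zero {R : Type*} [CommRing R] {P : Polynomial R}
    (h0 : P.eval 0 = 0) (h1 : (Polynomial.derivative P).eval 0 = 0) : Polynomial.X ^ 2 ∣ P := by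
  obtain ⟨Q, hQ⟩ : Polynomial.X ∣ P := by
    rw [Polynomial.X_dvd_iff, Polynomial.coeff_zero_eq_eval_zero]; exact h0
  have hQ0 : Q.eval 0 = 0 := by
    have := h1
    rw [hQ, Polynomial.derivative_mul, Polynomial.derivative_X, one_mul, Polynomial.eval_add,
      Polynomial.eval_mul, Polynomial.eval_X, zero_mul, add_zero] at this
    exact this
  obtain ⟨Q', hQ'⟩ : Polynomial.X ∣ Q := by
    rw [Polynomial.X_dvd_iff, Polynomial.coeff_zero_eq_eval_zero]; exact hQ0
  exact ⟨Q', by rw [hQ, hQ', pow_two, mul_assoc]⟩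

/-- If `X ∣ Q` then `X ^ e ∣ Q ^ e`. [folklore] -/
theorem X_pow_dvd_pow_of_eval_zero {R : Type*} [CommRing R] {Q : Polynomial R} (h0 : Q.eval 0 = 0) (e : ℕ) :
    Polynomial.X ^ e ∣ Q ^ e :=
  pow_dvd_pow_of_dvd (by rw [Polynomial.X_dvd_iff, Polynomial.coeff_zero_eq_eval_zero]; exact h0) e

/-! ### §3 Multiplicity at least two from divisibility of the partials -/

open MvPolynomial in
/-- **If an irreducible `h ∈ ℂ[x_σ]` with `h ∤ R` divides every partial derivative of `h^e · R` (`e ≥ 1`), then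
`e ≥ 2`.**  For `e = 1`, `∂_k(hR) = ∂_k h · R + h · ∂_k R`, so `h ∣ ∂_k h · R`, hence `h ∣ ∂_k h` (`h` prime,
`h ∤ R`), forcing `∂_k h = 0` for all `k` (degree), i.e. `h` constant — not irreducible. [folklore] -/
theorem two_le_of_dvd_pderiv {σ : Type*} {h R : MvPolynomial σ ℂ} (hh : Irreducible h) (hR : ¬ h ∣ R)
    {e : ℕ} (he : 1 ≤ e) (hdvd : ∀ k, h ∣ pderiv k (h ^ e * R)) : 2 ≤ e := by
  by_contra hlt
  have he1 : e = 1 := by omega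
  subst he1
  have hprime : Prime h := hh.prime
  have hall : ∀ k, pderiv k h = 0 := by
    intro k
    have hk := hdvd k
    rw [pow_one, Derivation.leibniz, smul_eq_mul, smul_eq_mul] at hk
    -- `h ∣ h * ∂R + R * ∂h` ⇒ `h ∣ R * ∂h`
    have h2 : h ∣ R * pderiv k h := by
      have : h ∣ h * pderiv k R := dvd_mul_right h _
      exact (dvd_add_right this).mp hk
    rcases hprime.dvd_or_dvd h2 with h3 | h3
    · exact absurd h3 hR
    · by_contra hne
      have hle : h.totalDegree ≤ (pderiv k h).totalDegree := totalDegree_le_of_dvd_of_isDomain h3 hne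
      have hlt' := Literature.Algebra.Polynomial.JacobianCriterion.totalDegree_pderiv_lt hne
      omega
  have hC : h = C (coeff 0 h) := Literature.Algebra.Polynomial.JacobianCriterion.eq_C_of_forall_pderiv_eq_zero hall
  have hc0 : coeff 0 h ≠ 0 := fun h0 => hh.ne_zero (by rw [hC, h0, map_zero])
  exact hh.not_isUnit (by rw [hC]; exact (isUnit_iff_ne_zero.mpr hc0).map C)

open MvPolynomial in
/-- A prime factor of a product of pairwise non-associated irreducibles (times a unit) divides none of the others:
`h_{j₀} ∤ w · ∏_{j ≠ j₀} h_j^{e_j}`. [folklore] -/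
theorem not_dvd_unit_mul_prod_erase {σ : Type*} {m : ℕ} {w : MvPolynomial σ ℂ} (hw : IsUnit w)
    {h : Fin m → MvPolynomial σ ℂ} (hirr : ∀ j, Irreducible (h j))
    (hna : ∀ i j, i ≠ j → ¬ Associated (h i) (h j)) (e : Fin m → ℕ) (j₀ : Fin m) :
    ¬ h j₀ ∣ w * ∏ j ∈ Finset.univ.erase j₀, h j ^ e j := by
  classical
  intro hdvd
  have hprime : Prime (h j₀) := (hirr j₀).prime
  rcases hprime.dvd_or_dvd hdvd with h1 | h1
  · exact (hirr j₀).not_isUnit (isUnit_of_dvd_unit h1 hw)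
  · obtain ⟨j, hj, hdj⟩ := (Prime.dvd_finsetProd_iff hprime _).mp h1
    have hdj' : h j₀ ∣ h j := hprime.dvd_of_dvd_pow hdj
    have hassoc : Associated (h j₀) (h j) := (hirr j₀).associated_of_dvd (hirr j) hdj'
    exact hna j₀ j (Finset.ne_of_mem_erase hj).symm hassoc

end Summit.HodgeConjecture.HodgeConjecture.Theorems.SignSymmetricPowersGenPairOrder

end
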